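import Literature.Analysis.FluidPDE.IntermittentJets
import Literature.Analysis.FunctionSpaces.FlatTorusProofs
import HarnessLib

/-!
# Intermittent jets: the space–time support of the building blocks and its measure
  (Luo–Titi 2020, §3.2: `‖η_(ξ)‖_{L^p} ≲ r^{3/2-3/p}`; Buckmaster–Vicol 2019 survey, §7.4 (7.22)–(7.24))

Analysis/FluidPDE support file (everything proved; no named facts). The intermittent gain of the
building blocks of the scheme — Luo–Titi, Calc. Var. PDE 59 (2020) = arXiv:1808.07595, §3.2:
"`⨍ η²_(ξ) = 1`, `‖η_(ξ)‖_{L^∞_t L^p_x} ≲ r^{3/2-3/p}`", Buckmaster–Vicol, EMS Surv. Math. Sci.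
6 (2019), §7.4 (7.24): "`‖W_(ξ)‖_{L^p} ≲ r_⊥^{2/p-1} r_∥^{1/p-1/2}`" — is, for the compactly
supported jets of the tree (`FluidPDE/IntermittentJets`: axial factor `η_x(t) = g̃_κ(σk_x·Y + ωt)`
with `g` a bump, transverse factors `ψ̃_x`, `∇φ̃_x` pulled back from compactly supported
profiles concentrated at scale `μ⁻¹`), the statement that at each time the jet of direction `x`
lives on a CLOSED set `E_x(t)` ("tube ∩ window") of Haar measure `≤ κ⁻¹ · C μ^{-(d-1)}`; the
`L^p` sizes then follow from `sup × |E|^{1/p}` (`Torus.eLpNorm_le_of_forall_norm_le_of_eq_zero_off`,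
`FluidPDE/FracHyperviscousEstimate`). Contents:

* `Jet.tubeSet m μ = proj '' B̄(c₀, 1/(4μ)) ⊂ 𝕋^m` — closed, of measure `≤ |B̄(c₀,1/(4μ))|`, and
  every concentrated periodic profile `conc κ₀ a μ f₀` vanishes off it;
* the axial window: `g̃_κ(r) ≠ 0 ⇒ r mod 1 ∈ B̄(1/(2κ), 1/(2κ)) ⊂ 𝕋¹` (`IsBump`), an arc of
  measure `≤ κ⁻¹`;
* `Jet.jetSupport J s x t ⊂ 𝕋^d` — the preimage of (arc × tube) under
  `y ↦ (χ_{k_x}, L_x)(σ • (y - s_x))`: closed, measurable, of measure `≤ κ⁻¹ |B̄(c₀, 1/(4μ))|`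
  (the joint homomorphism, the dilation `y ↦ σ • y` and translations preserve Haar measure:
  `Jet.measurePreserving_jointHom`, `measurePreserving_nsmul_unitAddTorus`), and OFF WHICH
  `η_x(t)`, `η'_x(t)`, `ψ̃_x`, `∂ⱼφ̃_x`, `∇φ̃_x` all vanish;
* `Torus.partialDeriv_eq_zero_of_forall_mem_isOpen` and iterates: a function vanishing on an open
  set has vanishing partial derivatives (and `Δ∂ₘ`) there — so every product containing one of
  the factors above, and all its derivatives, vanish on the open complement of `jetSupport`.

## References

* T. Luo, E. S. Titi, Calc. Var. PDE 59 (2020) = arXiv:1808.07595, §3.2 (after (3.3)), Prop. 4.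
  [`LuoTiti2020`]
* T. Buckmaster, V. Vicol, EMS Surv. Math. Sci. 6 (2019) = arXiv:1901.09023, §7.4 (7.22)–(7.24).
  [`BuckmasterVicol2020`]
-/

noncomputable section

open MeasureTheory Set Function Filter Topology UnitAddTorus Metric
open scoped ContDiff ENNReal

namespace Literature.Analysis.FluidPDE

/-! ## Derivatives of functions vanishing on an open set -/

namespace Torus

open FunctionSpaces FunctionSpaces.Torus

variable {d : Type*} [Fintype d] [DecidableEq d]
variable {F : Type*} [NormedAddCommGroup F] [NormedSpace ℝ F]

/-- **A function vanishing on an open set has vanishing partial derivatives there.** [folklore] -/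
theorem partialDeriv_eq_zero_of_forall_mem_isOpen {f : UnitAddTorus d → F} {U : Set (UnitAddTorus d)}
    (hU : IsOpen U) (hf : ∀ y ∈ U, f y = 0) (i : d) {y : UnitAddTorus d} (hy : y ∈ U) :
    Torus.partialDeriv i f y = 0 := by
  unfold FunctionSpaces.Torus.partialDeriv FunctionSpaces.Torus.lineDeriv
  have hc : Continuous fun t : ℝ => y + proj (t • EuclideanSpace.single i (1 : ℝ)) :=
    continuous_const.add (continuous_proj.comp (continuous_id.smul continuous_const))
  have h0 : y + proj ((0 : ℝ) • EuclideanSpace.single i (1 : ℝ)) = y := by simp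
  have hev : (fun t : ℝ => f (y + proj (t • EuclideanSpace.single i (1 : ℝ)))) =ᶠ[𝓝 0] fun _ => 0 := by
    have hpre : (fun t : ℝ => y + proj (t • EuclideanSpace.single i (1 : ℝ))) ⁻¹' U ∈ 𝓝 (0 : ℝ) :=
      hc.continuousAt.preimage_mem_nhds (by rw [h0]; exact hU.mem_nhds hy)
    filter_upwards [hpre] with t ht
    exact hf _ ht
  rw [hev.deriv_eq, deriv_const]

/-- Iterating: `∂ᵢ∂ⱼ f = 0` on an open set where `f = 0`. [folklore] -/
theorem partialDeriv_partialDeriv_eq_zero_of_forall_mem_isOpen {f : UnitAddTorus d → F} {U : Set (UnitAddTorus d)}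
    (hU : IsOpen U) (hf : ∀ y ∈ U, f y = 0) (i j : d) {y : UnitAddTorus d} (hy : y ∈ U) :
    Torus.partialDeriv i (Torus.partialDeriv j f) y = 0 :=
  partialDeriv_eq_zero_of_forall_mem_isOpen hU (fun _ hz => partialDeriv_eq_zero_of_forall_mem_isOpen hU hf j hz) i hy

/-- **`Δ(∂ₘ f) = 0` on an open set where the smooth `f` vanishes.** [folklore] -/
theorem laplacian_partialDeriv_eq_zero_of_forall_mem_isOpen {f : UnitAddTorus d → F} (hfs : IsSmooth f)
    {U : Set (UnitAddTorus d)} (hU : IsOpen U) (hf : ∀ y ∈ U, f y = 0) (m : d) {y : UnitAddTorus d} (hy : y ∈ U) :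
    Torus.laplacian (Torus.partialDeriv m f) y = 0 := by
  rw [laplacian_eq_sum_partialDeriv_partialDeriv (hfs.partialDeriv m) y]
  refine Finset.sum_eq_zero fun i _ => ?_
  exact partialDeriv_eq_zero_of_forall_mem_isOpen hU
    (fun _ hz => partialDeriv_partialDeriv_eq_zero_of_forall_mem_isOpen hU hf i m hz) i hy

/-- Closed-support form: if `f` vanishes off a closed set `E`, so do `∂ₘf` and `Δ∂ₘf`. [folklore] -/
theorem partialDeriv_eq_zero_off {f : UnitAddTorus d → F} {E : Set (UnitAddTorus d)} (hE : IsClosed E)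
    (hf : ∀ y ∉ E, f y = 0) (m : d) {y : UnitAddTorus d} (hy : y ∉ E) : Torus.partialDeriv m f y = 0 :=
  partialDeriv_eq_zero_of_forall_mem_isOpen hE.isOpen_compl (fun z hz => hf z hz) m hy

/-- Closed-support form for `Δ∂ₘ`. [folklore] -/
theorem laplacian_partialDeriv_eq_zero_off {f : UnitAddTorus d → F} (hfs : IsSmooth f) {E : Set (UnitAddTorus d)}
    (hE : IsClosed E) (hf : ∀ y ∉ E, f y = 0) (m : d) {y : UnitAddTorus d} (hy : y ∉ E) :
    Torus.laplacian (Torus.partialDeriv m f) y = 0 :=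
  laplacian_partialDeriv_eq_zero_of_forall_mem_isOpen hfs hE.isOpen_compl (fun z hz => hf z hz) m hy

end Torus

/-! ## The axial window of the profile `g_κ` -/

namespace Intermittent

variable {g : ℝ → ℝ} {κ : ℝ}

/-- **The window of `g_κ` on the circle**: if `g_κ(r) ≠ 0` (`g` a bump, `κ ≥ 1`) then `r mod 1`
lies in the closed arc of radius `1/(2κ)` around `1/(2κ)` — `g_κ = κ^{1/2}g(κ·)` on `[0,1)` and
`g` is supported inside `(0, 1)`. [folklore] -/
theorem IsBump.coe_mem_closedBall_of_profile_ne_zero (hg : IsBump g) (hκ : 1 ≤ κ) {r : ℝ}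
    (hr : profile κ g r ≠ 0) :
    ((r : ℝ) : UnitAddCircle) ∈ closedBall ((((2 * κ)⁻¹ : ℝ)) : UnitAddCircle) ((2 * κ)⁻¹) := by
  have hκ0 : 0 < κ := by linarith
  set w : ℝ := FunctionSpaces.timeWrap 0 1 r with hw_def
  have hgw : g (κ * w) ≠ 0 := by
    intro h0
    apply hr
    simp [profile, FunctionSpaces.timePeriodize_apply, rescale_apply, ← hw_def, h0]
  obtain ⟨lo, hi, hlo, hhi, hsupp⟩ := hg.exists_Icc
  have hm : κ * w ∈ Icc lo hi := hsupp (subset_tsupport _ (mem_support.2 hgw))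
  have hw1 : 0 < w := by
    rcases le_or_gt w 0 with hneg | hpos
    · have : κ * w ≤ 0 := mul_nonpos_of_nonneg_of_nonpos hκ0.le hneg
      linarith [hm.1]
    · exact hpos
  have hw2 : w * κ < 1 := by nlinarith [hm.2]
  -- `↑r = ↑w`
  have hrw : ((r : ℝ) : UnitAddCircle) = ((w : ℝ) : UnitAddCircle) := by
    rw [← sub_eq_zero, ← AddCircle.coe_sub, AddCircle.coe_eq_zero_iff]
    refine ⟨⌊(r - 0) / 1⌋, ?_⟩
    rw [hw_def, FunctionSpaces.timeWrap_def]
    simp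
  rw [hrw, mem_closedBall, dist_eq_norm, ← AddCircle.coe_sub, UnitAddCircle.norm_eq]
  have h1 := round_le (w - (2 * κ)⁻¹) 0
  rw [Int.cast_zero, sub_zero] at h1
  refine h1.trans (abs_le.2 ⟨by nlinarith [inv_pos.2 hκ0], ?_⟩)
  have : w < κ⁻¹ := by rw [lt_inv_comm₀ hw1 hκ0]; rw [inv_eq_one_div, lt_div_iff₀ hw1]; linarith
  have e : (2 * κ)⁻¹ = κ⁻¹ / 2 := by rw [mul_inv, inv_eq_one_div (2:ℝ)]; ring
  rw [e]
  linarith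

/-- The measure of the axial window: `|B̄(c, 1/(2κ))| ≤ κ⁻¹` on `𝕋¹` (`κ ≥ 1`). [folklore] -/
theorem volume_closedBall_le_inv (hκ : 1 ≤ κ) (c : UnitAddCircle) :
    volume (closedBall c ((2 * κ)⁻¹)) ≤ ENNReal.ofReal κ⁻¹ := by
  rw [AddCircle.volume_closedBall]
  refine ENNReal.ofReal_le_ofReal ((min_le_right _ _).trans (le_of_eq ?_))
  have hκ0 : (κ : ℝ) ≠ 0 := by positivity
  field_simp

end Intermittent

/-! ## The transverse tube -/

namespace Jet

open FunctionSpaces FunctionSpaces.Torus Mikado NashGeometric Transverse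

variable {d : Type*} [Fintype d] [DecidableEq d]

section Tube

variable (m : Type*) [Fintype m]

/-- The transverse ball `B̄(c₀, 1/(4μ)) ⊂ ℝ^m` carrying every concentrated profile at scale `μ`. [folklore] -/
def tubeBall (μ : ℝ) : Set (EuclideanSpace ℝ m) := closedBall (centre m) (1 / 4 / μ)

/-- **The transverse tube** `proj '' B̄(c₀, 1/(4μ)) ⊂ 𝕋^m`. [folklore] -/
def tubeSet (μ : ℝ) : Set (UnitAddTorus m) := proj '' tubeBall m μ

variable {m}

/-- The tube is compact. [folklore] -/
theorem isCompact_tubeSet (μ : ℝ) : IsCompact (tubeSet m μ) :=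
  (isCompact_closedBall _ _).image continuous_proj

/-- The tube is closed. [folklore] -/
theorem isClosed_tubeSet (μ : ℝ) : IsClosed (tubeSet m μ) := (isCompact_tubeSet μ).isClosed

/-- The tube is measurable. [folklore] -/
theorem measurableSet_tubeSet (μ : ℝ) : MeasurableSet (tubeSet m μ) := (isClosed_tubeSet μ).measurableSet

/-- For `μ ≥ 1` the transverse ball lies in the open unit cube. [folklore] -/
theorem tubeBall_subset_unitCube {μ : ℝ} (hμ : 1 ≤ μ) : tubeBall m μ ⊆ unitCube m := by
  intro z hz i
  have hr : (1 : ℝ) / 4 / μ < 1 / 2 := by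
    rw [div_lt_iff₀ (by linarith)]; linarith
  have h := mem_openCube_of_mem_closedBall hr hz i
  exact ⟨h.1.le, h.2⟩

/-- `z ∈ tubeSet ↔ repr z ∈ B̄(c₀, 1/(4μ))` (`μ ≥ 1`). [folklore] -/
theorem mem_tubeSet_iff {μ : ℝ} (hμ : 1 ≤ μ) (z : UnitAddTorus m) : z ∈ tubeSet m μ ↔ repr z ∈ tubeBall m μ := by
  constructor
  · rintro ⟨b, hb, rfl⟩
    rw [repr_proj_of_mem_unitCube_holds (tubeBall_subset_unitCube hμ hb)]
    exact hb
  · intro h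
    exact ⟨repr z, h, proj_repr z⟩

/-- **Concentrated profiles vanish off the tube**: `conc κ₀ a μ f₀ (z) ≠ 0 ⇒ z ∈ tubeSet`
(`f₀` a profile, `μ ≥ 1`). [folklore] -/
theorem mem_tubeSet_of_conc_ne_zero [DecidableEq m] {f₀ : EuclideanSpace ℝ m → ℝ} (hf : IsProfile f₀) {μ : ℝ} (hμ : 1 ≤ μ)
    (κ₀ a : ℝ) {z : UnitAddTorus m} (hz : conc κ₀ a μ f₀ z ≠ 0) : z ∈ tubeSet m μ := by
  rw [mem_tubeSet_iff hμ]
  rw [conc_apply hf hμ] at hz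
  have h1 : Transverse.rescale a μ f₀ (repr z) ≠ 0 := fun h => hz (by rw [h, mul_zero])
  have h2 := tsupport_rescale_subset (by linarith : (0 : ℝ) < μ) hf.tsupport_subset a
    (subset_tsupport _ (mem_support.2 h1))
  simpa [tubeBall] using h2

/-- **The measure of the tube**: `|tubeSet| ≤ |B̄(c₀, 1/(4μ))|_{ℝ^m} = (1/(4μ))^m |B̄(0,1)|`
(`repr` pushes Haar measure to Lebesgue measure on the unit cube). [folklore] -/
theorem volume_tubeSet_le {μ : ℝ} (hμ : 1 ≤ μ) :
    volume (tubeSet m μ) ≤ ENNReal.ofReal ((1 / 4 / μ) ^ Fintype.card m) *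
      volume (ball (0 : EuclideanSpace ℝ m) 1) := by
  have hsub : tubeSet m μ ⊆ repr ⁻¹' tubeBall m μ := fun z hz => (mem_tubeSet_iff hμ z).1 hz
  have hmeas : MeasurableSet (tubeBall m μ) := isClosed_closedBall.measurableSet
  calc volume (tubeSet m μ) ≤ volume (repr ⁻¹' tubeBall m μ) := measure_mono hsub
    _ = (volume.restrict (unitCube m)) (tubeBall m μ) :=
        (measurePreserving_repr (d := m)).measure_preimage hmeas.nullMeasurableSet
    _ ≤ volume (tubeBall m μ) := Measure.restrict_le_self _
    _ = ENNReal.ofReal ((1 / 4 / μ) ^ Fintype.card m) * volume (ball (0 : EuclideanSpace ℝ m) 1) := by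
        rw [tubeBall, Measure.addHaar_closedBall _ _ (by positivity : (0 : ℝ) ≤ 1 / 4 / μ), finrank_euclideanSpace]

end Tube

/-! ## The support set of a jet -/

section Support

variable (J : Params) (s : Index d → UnitAddTorus d) (x : Index d) (t : ℝ)

/-- The centre of the axial window of the jet of direction `x` at time `t`, as an element of
`𝕋¹` (the phase `σk_x·Y + ωt` recentred by the shift `s_x`). [folklore] -/
def axialCentre : UnitAddCircle :=
  ((((2 * J.κ)⁻¹ - J.om * t : ℝ)) : UnitAddCircle) - chi (dir x) (J.σ • s x)

/-- The joint phase/transverse map of the jet of direction `x`: `y ↦ (χ_{k_x}, L_x)(σ • (y - s_x))`. [folklore] -/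
def jetMap (y : UnitAddTorus d) : UnitAddCircle × UnitAddTorus (Slot x) :=
  jointHom (datum x) (dir x) (J.σ • (y - s x))

/-- **The support set of the jet of direction `x` at time `t`**: axial window × transverse tube,
pulled back by `jetMap`. [folklore] -/
def jetSupport : Set (UnitAddTorus d) :=
  jetMap J s x ⁻¹' (closedBall (axialCentre J s x t) ((2 * J.κ)⁻¹) ×ˢ tubeSet (Slot x) J.μ)

variable {J s x t}

omit [DecidableEq d] in
/-- `jetMap` is continuous. [folklore] -/
theorem continuous_jetMap [DecidableEq d] : Continuous (jetMap J s x) :=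
  (continuous_jointHom _ _).comp ((continuous_nsmul J.σ).comp (continuous_id.sub continuous_const))

/-- The support set is closed. [folklore] -/
theorem isClosed_jetSupport : IsClosed (jetSupport J s x t) :=
  (isClosed_closedBall.prod (isClosed_tubeSet J.μ)).preimage continuous_jetMap

/-- The support set is measurable. [folklore] -/
theorem measurableSet_jetSupport : MeasurableSet (jetSupport J s x t) := isClosed_jetSupport.measurableSet

/-- **`jetMap` preserves Haar measure** (translation, integer dilation and the joint homomorphism
all do). [folklore] -/
theorem measurePreserving_jetMap (h : J.Valid) : MeasurePreserving (jetMap J s x) volume volume := by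
  have h1 : MeasurePreserving (fun y : UnitAddTorus d => y - s x) volume volume := measurePreserving_sub_right volume (s x)
  have h2 : MeasurePreserving (fun y : UnitAddTorus d => J.σ • y) volume volume := measurePreserving_nsmul_unitAddTorus h.hσ
  have h3 := measurePreserving_jointHom (datum x) (dir x) (sum_dir_mul_dir_ne_zero x)
  exact h3.comp (h2.comp h1)

/-- **The measure of the support set**: `|jetSupport| ≤ κ⁻¹ · (1/(4μ))^{d-1} |B̄_{ℝ^{d-1}}(0,1)|`. [cite: BuckmasterVicol2020, §7.4 (7.24)] -/
theorem volume_jetSupport_le (h : J.Valid) :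
    volume (jetSupport J s x t) ≤ ENNReal.ofReal J.κ⁻¹ *
      (ENNReal.ofReal ((1 / 4 / J.μ) ^ Fintype.card (Slot x)) * volume (ball (0 : EuclideanSpace ℝ (Slot x)) 1)) := by
  have hA : MeasurableSet (closedBall (axialCentre J s x t) ((2 * J.κ)⁻¹) ×ˢ tubeSet (Slot x) J.μ) :=
    isClosed_closedBall.measurableSet.prod (measurableSet_tubeSet J.μ)
  rw [jetSupport, (measurePreserving_jetMap h).measure_preimage hA.nullMeasurableSet,
    show (volume : Measure (UnitAddCircle × UnitAddTorus (Slot x))) = (volume : Measure UnitAddCircle).prod volume from rfl,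
    Measure.prod_prod]
  exact mul_le_mul' (Intermittent.volume_closedBall_le_inv h.hκ _) (volume_tubeSet_le h.hμ)

/-! ### The blocks vanish off the support set -/

/-- `χ_{σk}(y) = χ_k(σ • y)`. [folklore] -/
theorem chi_nvec (y : UnitAddTorus d) : chi ((nvec J) x) y = chi (dir x) (J.σ • y) := by
  simp only [chi_apply, nvec, Pi.smul_apply]
  refine Finset.sum_congr rfl fun l _ => ?_
  rw [mul_zsmul, natCast_zsmul, smul_comm]

/-- The phase of the axial factor through `jetMap`:
`χ_{σk_x} y + ωt = (jetMap y).1 + (ωt + χ_{k_x}(σ • s_x))`. [folklore] -/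
theorem chi_nvec_add (y : UnitAddTorus d) :
    chi ((nvec J) x) y + (((J.om * t : ℝ)) : UnitAddCircle) =
      (jetMap J s x y).1 + ((((J.om * t : ℝ)) : UnitAddCircle) + chi (dir x) (J.σ • s x)) := by
  rw [chi_nvec, jetMap, jointHom_apply]
  dsimp only
  rw [smul_sub, map_sub]
  abel

/-- **The axial phase lies in the window wherever the axial function is non-zero**: if
`P(r) ≠ 0` forces `r mod 1 ∈ B̄(1/(2κ), 1/(2κ))`, then `P̃(χ_{σk_x} y + ωt) ≠ 0` forces the first
component of `jetMap y` into the arc `B̄(axialCentre, 1/(2κ))`. [folklore] -/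
theorem fst_jetMap_mem_of_profile_ne_zero (h : J.Valid) {P : ℝ → ℝ} (hP : Periodic P 1)
    (hwin : ∀ r, P r ≠ 0 → ((r : ℝ) : UnitAddCircle) ∈ closedBall ((((2 * J.κ)⁻¹ : ℝ)) : UnitAddCircle) ((2 * J.κ)⁻¹))
    {y : UnitAddTorus d} (hy : axialFn hP ((nvec J) x) (J.om * t) y ≠ 0) :
    (jetMap J s x y).1 ∈ closedBall (axialCentre J s x t) ((2 * J.κ)⁻¹) := by
  have _ := h
  unfold axialFn at hy
  obtain ⟨r, hr⟩ := QuotientAddGroup.mk_surjective (chi ((nvec J) x) y + (((J.om * t : ℝ)) : UnitAddCircle))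
  have hPr : P r ≠ 0 := by
    rw [← hr] at hy
    exact hy
  have hmem := hwin r hPr
  -- `(jetMap y).1 = ↑r - (ωt + χ(σ s))`
  have e : (jetMap J s x y).1 = ((r : ℝ) : UnitAddCircle) - ((((J.om * t : ℝ)) : UnitAddCircle) + chi (dir x) (J.σ • s x)) := by
    rw [eq_sub_iff_add_eq, ← chi_nvec_add]
    exact hr.symm
  rw [e, axialCentre, mem_closedBall]
  rw [mem_closedBall] at hmem
  calc dist (((r : ℝ) : UnitAddCircle) - ((((J.om * t : ℝ)) : UnitAddCircle) + chi (dir x) (J.σ • s x)))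
        (((((2 * J.κ)⁻¹ - J.om * t : ℝ)) : UnitAddCircle) - chi (dir x) (J.σ • s x))
      = dist ((r : ℝ) : UnitAddCircle) ((((2 * J.κ)⁻¹ : ℝ)) : UnitAddCircle) := by
        rw [dist_eq_norm, dist_eq_norm]
        congr 1
        rw [AddCircle.coe_sub]
        abel
    _ ≤ (2 * J.κ)⁻¹ := hmem

/-- **`η_x(t)` vanishes off the support set.** [folklore] -/
theorem eta_eq_zero_of_not_mem (h : J.Valid) {y : UnitAddTorus d} (hy : y ∉ jetSupport J s x t)
    (htr : (jetMap J s x y).2 ∈ tubeSet (Slot x) J.μ) : (eta J) x t y = 0 := by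
  by_contra hne
  have h1 := fst_jetMap_mem_of_profile_ne_zero (s := s) h (prof_periodic J)
    (fun r hr => h.hg.coe_mem_closedBall_of_profile_ne_zero h.hκ hr) hne
  exact hy ⟨h1, htr⟩

/-- **`η'_x(t)` vanishes off the support set** (`(g_κ)' = κ(g')_κ` and `g'` is a bump with the
same window). [folklore] -/
theorem etaD_eq_zero_of_not_mem (h : J.Valid) {y : UnitAddTorus d} (hy : y ∉ jetSupport J s x t)
    (htr : (jetMap J s x y).2 ∈ tubeSet (Slot x) J.μ) : (etaD J) x t y = 0 := by
  by_contra hne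
  have hwin : ∀ r, deriv (prof J) r ≠ 0 →
      ((r : ℝ) : UnitAddCircle) ∈ closedBall ((((2 * J.κ)⁻¹ : ℝ)) : UnitAddCircle) ((2 * J.κ)⁻¹) := by
    intro r hr
    rw [show prof J = Intermittent.profile J.κ J.g from rfl, h.hg.deriv_profile h.hκ] at hr
    beta_reduce at hr
    have hr' : Intermittent.profile J.κ (deriv J.g) r ≠ 0 := fun h0 => hr (by rw [h0, mul_zero])
    exact h.hg.deriv.coe_mem_closedBall_of_profile_ne_zero h.hκ hr'
  have h1 := fst_jetMap_mem_of_profile_ne_zero (s := s) h (periodic_deriv (prof_periodic J)) hwin hne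
  exact hy ⟨h1, htr⟩

/-- **The transverse factor `ψ̃_x` vanishes off the tube** (hence off the support set). [folklore] -/
theorem snd_jetMap_mem_of_psiJ_ne_zero (h : J.Valid) {y : UnitAddTorus d} (hy : psiJ J s x y ≠ 0) :
    (jetMap J s x y).2 ∈ tubeSet (Slot x) J.μ := by
  have e : psiJ J s x y = conc (normConst (datum x).c) ((Fintype.card (Slot x) : ℝ) / 2) J.μ (psi0 (datum x).c)
      ((datum x).hom (J.σ • (y - s x))) := rfl
  rw [e] at hy
  exact mem_tubeSet_of_conc_ne_zero (isProfile_psi0 _) h.hμ _ _ hy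

/-- **`∂ⱼφ̃_x` vanishes off the tube.** [folklore] -/
theorem snd_jetMap_mem_of_partialDeriv_phiJ_ne_zero (h : J.Valid) (j : d) {y : UnitAddTorus d}
    (hy : Torus.partialDeriv j (phiJ J s x) y ≠ 0) : (jetMap J s x y).2 ∈ tubeSet (Slot x) J.μ := by
  have hμ := h.hμ
  have e1 : Torus.partialDeriv j (phiJ J s x) y = ((J.σ : ℝ))⁻¹ * Torus.partialDeriv j (phi x J.μ) (J.σ • (y - s x)) := by
    have h1 := congr_fun (partialDeriv_comp_sub j (phiR x J.μ J.σ) (s x)) y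
    rw [show phiJ J s x = fun y => phiR x J.μ J.σ (y - s x) from rfl, h1, partialDeriv_phiR x hμ h.hσ]
  have eG : Torus.partialDeriv j (phi x J.μ) = fun z => ∑ l', ((datum x).A j l' : ℝ) *
      (datum x).pull (conc (normConst (datum x).c) ((Fintype.card (Slot x) : ℝ) / 2 - 2 + 1) J.μ (pd l' (phi0 (datum x).c))) z :=
    partialDeriv_pull_conc (datum x) (isProfile_phi0 _) hμ _ _ j
  rw [e1, eG] at hy
  beta_reduce at hy
  have hsum : ∑ l', ((datum x).A j l' : ℝ) * (datum x).pull (conc (normConst (datum x).c)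
      ((Fintype.card (Slot x) : ℝ) / 2 - 2 + 1) J.μ (pd l' (phi0 (datum x).c))) (J.σ • (y - s x)) ≠ 0 := fun h0 => hy (by rw [h0, mul_zero])
  obtain ⟨l', -, hl'⟩ := Finset.exists_ne_zero_of_sum_ne_zero hsum
  have hne : (datum x).pull (conc (normConst (datum x).c) ((Fintype.card (Slot x) : ℝ) / 2 - 2 + 1) J.μ
      (pd l' (phi0 (datum x).c))) (J.σ • (y - s x)) ≠ 0 := fun h0 => hl' (by rw [h0, mul_zero])
  exact mem_tubeSet_of_conc_ne_zero ((isProfile_phi0 _).pd l') hμ _ _ hne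

/-- **`ψ̃_x` vanishes off the support set** given the axial window (or unconditionally off the tube). [folklore] -/
theorem psiJ_eq_zero_of_not_mem_tube (h : J.Valid) {y : UnitAddTorus d} (hy : (jetMap J s x y).2 ∉ tubeSet (Slot x) J.μ) :
    psiJ J s x y = 0 := by
  by_contra hne
  exact hy (snd_jetMap_mem_of_psiJ_ne_zero h hne)

/-- **`∂ⱼφ̃_x` vanishes off the tube.** [folklore] -/
theorem partialDeriv_phiJ_eq_zero_of_not_mem_tube (h : J.Valid) (j : d) {y : UnitAddTorus d}
    (hy : (jetMap J s x y).2 ∉ tubeSet (Slot x) J.μ) : Torus.partialDeriv j (phiJ J s x) y = 0 := by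
  by_contra hne
  exact hy (snd_jetMap_mem_of_partialDeriv_phiJ_ne_zero h j hne)

/-- **`∇φ̃_x` vanishes off the tube.** [folklore] -/
theorem gradient_phiJ_eq_zero_of_not_mem_tube (h : J.Valid) {y : UnitAddTorus d}
    (hy : (jetMap J s x y).2 ∉ tubeSet (Slot x) J.μ) : Torus.gradient (phiJ J s x) y = 0 := by
  rw [gradient_eq_sum_partialDeriv ((isSmooth_phiJ s h x).isContDiff (by simp))]
  exact Finset.sum_eq_zero fun j _ => by rw [partialDeriv_phiJ_eq_zero_of_not_mem_tube h j hy, zero_smul]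

/-- **Products vanish off the support set**: a product of an axial factor value `A` and a
transverse factor value `B` of the jet of direction `x` at time `t` vanishes at `y ∉ jetSupport`,
provided `A = 0` off the window (given the tube) and `B = 0` off the tube. This is the form in
which every piece of the perturbation (`a η ψ̃ k`, `a σ|k|²η' ∇φ̃`, `η(∇φ̃·∇a)k`, `η(k·∇a)∇φ̃`,
`a²η²ψ̃²`) is seen to vanish off `jetSupport`. [folklore] -/
theorem axial_mul_transverse_eq_zero_of_not_mem {M : Type*} [MulZeroClass M] {A B : M} {y : UnitAddTorus d}
    (hy : y ∉ jetSupport J s x t)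
    (hA : (jetMap J s x y).2 ∈ tubeSet (Slot x) J.μ → y ∉ jetSupport J s x t → A = 0)
    (hB : (jetMap J s x y).2 ∉ tubeSet (Slot x) J.μ → B = 0) : A * B = 0 := by
  by_cases htr : (jetMap J s x y).2 ∈ tubeSet (Slot x) J.μ
  · rw [hA htr hy, zero_mul]
  · rw [hB htr, mul_zero]

end Support

end Jet

end Literature.Analysis.FluidPDE
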